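import Literature.NumberTheory.EllipticCurves.IwasawaAlgebraCharIdealProofs
import Literature.NumberTheory.EllipticCurves.Rubin1991.TwoVariableMainConjecture
import Mathlib.LinearAlgebra.Matrix.Charpoly.LinearMap
import Mathlib.RingTheory.UniqueFactorizationDomain.Ideal
import Mathlib.RingTheory.Ideal.Height
import Mathlib.RingTheory.PowerSeries.Ideal
import HarnessLib

/-!
# (α3) KERNEL DESCENT I — pseudo-null defects over `A⟦X⟧` and `Λ₂ = ℤ_p⟦T₂⟧⟦T₁⟧`:
# «killed by a non-zero constant of `A` and by a series with a unit coefficient ⟹ pseudo-null»,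
# «finitely generated over the coefficient ring `ℤ_p` ⟹ pseudo-null over `Λ₂`», and the extension closure of
# pointwise nullity at a prime

Cell `bsd-print-cf2`, width seat `bsd-line-cf2c-w8` g7 (prover-bsd-line-cf2c-w8-g7-0), lane **(α3) KERNEL DESCENT** of the
planner brief `Cruxes/MainConjClauseAtSplitTwoQuad/JLK-CARRIER-2-BRIEF-plan-g20.md` §2 for brick (a) of stub (Q) of the DECIDING
research child `PrintCf2RubinValueTwo.MainConjClauseAtSplitTwoQuadDA` (stmt-BirchSwinnertonDyer-24721); `--supports` that item
`--as helper`, Theses-free. HONEST FRAMING: generic commutative algebra. The three "≐" of the brief's §1 dictionary (Poitou–Tate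
row, units row, twist-vs-part) compare Rubin-module carriers (`ClassGroupDualData₂.X`, `UnitIndexData₂.Q`) with the
Johnson-Leung–Kings carriers (`H²`, `H¹/𝒥_Λζ`) through maps whose kernels and cokernels are (i) FINITELY GENERATED OVER `ℤ₂`
(local terms `⊕_{w∣2} ℤ₂⟦Γ/D_w⟧`-modules with `D_w` open, `2`-units/units, `Λ/𝒥_Λ ≅ ℤ₂`) or (ii) killed by a power of `2`
(`#Δ_θ = 2`, index defects). This file proves that defects of type (i) are PSEUDO-NULL over `Λ₂` (invisible to `charIdeal`)
and supplies the pointwise currency («every `m` is killed by some `r ∉ 𝔭`, for every prime `𝔭` of height `≤ 1`») that the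
tree's producers `FourTerm.exists_charIdeal_mul_pow_eq_of_away_ker_coker` / `…_of_injective_of_away` / `…_of_surjective_of_away`
(`PrintCf2RubinValueTwoLinePinCharIdealAwayCalculus`) and `FourTerm.isPseudoNull_ker_of_forall` consume; type (ii) is the tree's
`FourTerm.forall_away_of_forall_pow_smul_eq_zero`, and §4 here closes the pointwise currency under extensions (so «pseudo-null
⊕ `2`-primary», in any order of extension, is away-null). Nothing here touches a Galois group; no summit statement is proved
by this seat; BSD is not proved by any of this.

## Contents

* §1 (`A` a factorial domain, `A⟦X⟧`): **`not_height_le_one_of_C_mem_of_mem`** — a prime `𝔭 ⊂ A⟦X⟧` containing a non-zero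
  constant `C a` AND a series `b` one of whose coefficients is a unit of `A` has height `≥ 2`. Proof: `𝔭 ≠ ⊥`; the prime
  `𝔭 ∩ A ∋ a ≠ 0` of the UFD `A` contains a prime element `g`, and `C g` is prime in `A⟦X⟧` (tree `prime_C_of_prime`); were
  `ht 𝔭 = 1`, `𝔭 = (C g)` (Mathlib `Ideal.eq_span_singleton_of_height_eq_one`), so `C g ∣ b`, so `g` divides the unit
  coefficient of `b` — absurd. Pointwise corollary `C_notMem_or_notMem_of_height_le_one`.
* §2 (modules over `A⟦X⟧`): **`forall_exists_smul_eq_zero_of_smul_eq_zero₂`** / **`isPseudoNull_of_smul_eq_zero₂`** — a module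
  killed by such a pair `(C a, b)` is pseudo-null, pointwise and as `Module.IsPseudoNull`.
* §3 (`Λ₂(𝒪) = 𝒪⟦T₂⟧⟦T₁⟧`, `𝒪` a principal ideal domain — `ℤ_p`, or the `𝒪_𝔓` of JLK's `Λ_𝒪`): **`forall_exists_smul_eq_zero_of_moduleFinite`**
  / **`isPseudoNull_of_moduleFinite`** — an `𝒪⟦T₂⟧⟦T₁⟧`-module that is finitely generated over `𝒪` (compatible structures) is
  pseudo-null: Cayley–Hamilton (`LinearMap.exists_monic_and_aeval_eq_zero`) for the `𝒪`-linear actions of `T₁` and of `T₂`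
  gives monic `f₁, f₂ ∈ 𝒪[Y]` with `f₁(T₁)·M = 0 = f₂(T₂)·M`; `f₂(T₂)` is a non-zero constant of `A = 𝒪⟦T₂⟧` and `f₁(T₁)` has
  leading coefficient `1`, so §2 applies. Instance-free form `…_of_exists_finset` (every element a `C(C c)`-combination of a
  fixed finite set) and the `IwasawaAlgebra₂ p` spellings `…_iwasawaAlgebra₂`.
* §4 (any commutative ring, any prime `𝔭`): pointwise nullity at `𝔭` is closed under extensions (`Function.Exact`), submodules,
  quotients and images — `forall_exists_smul_eq_zero_of_exact` &c.

THEOREMS ONLY (no `def`, no named fact, no `sorry`). presearch: Bourbaki AC VII §4.4 (pseudo-null = support of codimension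
`≥ 2`); Neukirch–Schmidt–Wingberg V §1 (5.1.4)–(5.1.6) [corpus]; Johnson-Leung–Kings 2011 §5.1 «`Λ/𝒥_Λ ≅ ℤ_p` … hence
pseudo-null», Lemma 5.8 [corpus: arXiv 0804.2828 p0014]; folklore. beyond-print theorem: no.

References: N. Bourbaki, *Algèbre commutative* VII §4.4; Neukirch–Schmidt–Wingberg (2008) Ch. V §1 [NeukirchSchmidtWingberg2008];
J. Johnson-Leung, G. Kings, J. reine angew. Math. 653 (2011) §5.1, Lemma 5.8 [JohnsonLeungKings2011].
-/

noncomputable section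

set_option linter.dupNamespace false -- D-0017: single-problem summit, `…BirchSwinnertonDyer.BirchSwinnertonDyer…` repeats a namespace by design
set_option autoImplicit false

open scoped Classical
open Polynomial

namespace Summit.BirchSwinnertonDyer.BirchSwinnertonDyer.Theorems.PrintCf2.JLKDescent

open Literature.NumberTheory.EllipticCurves

universe u₁ u₂ u₃

/-! ## §1. A prime of `A⟦X⟧` through a non-zero constant and a series with a unit coefficient has height `≥ 2` -/

section HeightTwo

variable {A : Type*} [CommRing A] [IsDomain A] [UniqueFactorizationMonoid A]

/-- **Height bookkeeping in `A⟦X⟧`, `A` a factorial domain.** If a prime ideal `𝔭` of `A⟦X⟧` contains a non-zero constant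
`C a` and a power series `b` with a unit coefficient, then `𝔭` does NOT have height `≤ 1`. (Proof in the module docstring:
`𝔭 ∩ A ∋ a ≠ 0` contains a prime element `g`; `C g` is prime; a height-one `𝔭` would equal `(C g)`, forcing `g` to divide the
unit coefficient of `b`.) [folklore] -/
theorem not_height_le_one_of_C_mem_of_mem (𝔭 : Ideal (PowerSeries A)) [h𝔭 : 𝔭.IsPrime] {a : A} (ha : a ≠ 0)
    (haP : PowerSeries.C a ∈ 𝔭) {b : PowerSeries A} (hbP : b ∈ 𝔭) {n : ℕ} (hb : IsUnit (PowerSeries.coeff n b)) :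
    ¬ 𝔭.height ≤ 1 := by
  intro hle
  -- the prime `𝔭 ∩ A` of the UFD `A` is non-zero, hence contains a prime element `g`
  have h𝔮 : (𝔭.comap (PowerSeries.C (R := A))).IsPrime := Ideal.IsPrime.comap _
  have h𝔮ne : 𝔭.comap (PowerSeries.C (R := A)) ≠ ⊥ := fun h ↦ by
    have : a ∈ (⊥ : Ideal A) := h ▸ (Ideal.mem_comap.mpr haP)
    exact ha ((Submodule.mem_bot A).mp this)
  obtain ⟨g, hg𝔮, hg⟩ := h𝔮.exists_mem_prime_of_ne_bot h𝔮ne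
  have hCg : PowerSeries.C g ∈ 𝔭 := Ideal.mem_comap.mp hg𝔮
  have hCgprime : Prime (PowerSeries.C g : PowerSeries A) := prime_C_of_prime hg
  -- `ht 𝔭 ≠ 0` since `𝔭 ∋ C a ≠ 0`
  have h0 : 𝔭.height ≠ 0 := fun h0 ↦ by
    have hbot : 𝔭 = ⊥ := Ideal.height_eq_zero_iff_eq_bot.mp h0
    have : PowerSeries.C a = (0 : PowerSeries A) := (Submodule.mem_bot (PowerSeries A)).mp (hbot ▸ haP)
    exact ha (by simpa using congrArg PowerSeries.constantCoeff this)
  have h1 : 𝔭.height = 1 := le_antisymm hle (Order.one_le_iff_ne_zero.mpr h0)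
  -- so `𝔭 = (C g)` and `C g ∣ b`
  have heq : 𝔭 = Ideal.span {PowerSeries.C g} := Ideal.eq_span_singleton_of_height_eq_one h1 hCg hCgprime
  have hdvd : PowerSeries.C g ∣ b := Ideal.mem_span_singleton.mp (heq ▸ hbP)
  obtain ⟨c, hc⟩ := hdvd
  have hgdvd : g ∣ PowerSeries.coeff n b := ⟨PowerSeries.coeff n c, by rw [hc, PowerSeries.coeff_C_mul]⟩
  exact hg.not_unit (isUnit_of_dvd_unit hgdvd hb)

/-- Pointwise form of `not_height_le_one_of_C_mem_of_mem`: at a prime `𝔭` of height `≤ 1` of `A⟦X⟧`, a non-zero constant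
`C a` and a series `b` with a unit coefficient are not BOTH in `𝔭`. [folklore] -/
theorem C_notMem_or_notMem_of_height_le_one (𝔭 : PrimeSpectrum (PowerSeries A)) (h𝔭 : 𝔭.asIdeal.height ≤ 1)
    {a : A} (ha : a ≠ 0) {b : PowerSeries A} {n : ℕ} (hb : IsUnit (PowerSeries.coeff n b)) :
    PowerSeries.C a ∉ 𝔭.asIdeal ∨ b ∉ 𝔭.asIdeal := by
  by_contra h
  rw [not_or, not_not, not_not] at h
  exact not_height_le_one_of_C_mem_of_mem 𝔭.asIdeal ha h.1 h.2 hb h𝔭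

end HeightTwo

/-! ## §2. Modules over `A⟦X⟧` killed by such a pair are pseudo-null -/

section Modules

variable {A : Type*} [CommRing A] [IsDomain A] [UniqueFactorizationMonoid A]
  {M : Type u₁} [AddCommGroup M] [Module (PowerSeries A) M]

/-- **Pointwise pseudo-nullity from two annihilators.** If an `A⟦X⟧`-module `M` is killed by a non-zero constant `C a`
(`a ∈ A`) and by a series `b` with a unit coefficient, then at every prime `𝔭` of height `≤ 1` every `m : M` is killed by
some `r ∉ 𝔭` (namely by `C a` or by `b`). This is the currency of the tree's `FourTerm` producers (with their extra
hypothesis `ϖ ∉ 𝔭` simply unused). [cite: NeukirchSchmidtWingberg2008, Ch. V §1, (5.1.4) Remark 1] -/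
theorem forall_exists_smul_eq_zero_of_smul_eq_zero₂ {a : A} (ha : a ≠ 0) (haM : ∀ m : M, PowerSeries.C a • m = 0)
    {b : PowerSeries A} {n : ℕ} (hb : IsUnit (PowerSeries.coeff n b)) (hbM : ∀ m : M, b • m = 0) :
    ∀ 𝔭 : PrimeSpectrum (PowerSeries A), 𝔭.asIdeal.height ≤ 1 → ∀ m : M, ∃ r ∉ 𝔭.asIdeal, r • m = 0 := by
  intro 𝔭 h𝔭 m
  rcases C_notMem_or_notMem_of_height_le_one 𝔭 h𝔭 ha hb with h | h
  · exact ⟨_, h, haM m⟩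
  · exact ⟨_, h, hbM m⟩

/-- **`Module.IsPseudoNull` from two annihilators**: an `A⟦X⟧`-module killed by a non-zero constant of `A` and by a series
with a unit coefficient is pseudo-null (`M_𝔭 = 0` at every prime of height `≤ 1`).
[cite: NeukirchSchmidtWingberg2008, Ch. V §1, (5.1.4)–(5.1.5)] -/
theorem isPseudoNull_of_smul_eq_zero₂ {a : A} (ha : a ≠ 0) (haM : ∀ m : M, PowerSeries.C a • m = 0)
    {b : PowerSeries A} {n : ℕ} (hb : IsUnit (PowerSeries.coeff n b)) (hbM : ∀ m : M, b • m = 0) :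
    Module.IsPseudoNull (PowerSeries A) M := by
  intro 𝔭 h𝔭
  rw [LocalizedModule.subsingleton_iff]
  intro m
  obtain ⟨r, hr, hrm⟩ := forall_exists_smul_eq_zero_of_smul_eq_zero₂ ha haM hb hbM 𝔭 h𝔭 m
  exact ⟨r, hr, hrm⟩

end Modules

/-! ## §3. `𝒪⟦T₂⟧⟦T₁⟧`-modules finitely generated over `𝒪` are pseudo-null (`𝒪` a principal ideal domain) -/

section CoefficientFinite

variable {𝒪 : Type*} [CommRing 𝒪] [IsDomain 𝒪] [IsPrincipalIdealRing 𝒪]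
  {M : Type u₁} [AddCommGroup M] [Module (PowerSeries (PowerSeries 𝒪)) M]

omit [IsDomain 𝒪] [IsPrincipalIdealRing 𝒪] in
/-- Cayley–Hamilton in the form used here: if `M` is finitely generated over `𝒪` (compatibly with its `𝒪⟦T₂⟧⟦T₁⟧`-structure),
then every `x ∈ 𝒪⟦T₂⟧⟦T₁⟧` satisfies a MONIC polynomial `f ∈ 𝒪[Y]` on `M`: `f(x) • m = 0` for all `m`.
[folklore] -/
theorem exists_monic_aeval_smul_eq_zero [Module 𝒪 M] [IsScalarTower 𝒪 (PowerSeries (PowerSeries 𝒪)) M]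
    [Module.Finite 𝒪 M] (x : PowerSeries (PowerSeries 𝒪)) :
    ∃ f : 𝒪[X], f.Monic ∧ ∀ m : M, (Polynomial.aeval x f) • m = 0 := by
  obtain ⟨f, hf, hf0⟩ :=
    LinearMap.exists_monic_and_aeval_eq_zero 𝒪 (Algebra.lsmul 𝒪 𝒪 M x : Module.End 𝒪 M)
  refine ⟨f, hf, fun m ↦ ?_⟩
  have h := congrArg (fun φ : Module.End 𝒪 M ↦ φ m) hf0
  simp only [LinearMap.zero_apply] at h
  rwa [Polynomial.aeval_algHom_apply, Algebra.lsmul_coe] at h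

omit [IsDomain 𝒪] [IsPrincipalIdealRing 𝒪] in
/-- `f(T₁) ∈ 𝒪⟦T₂⟧⟦T₁⟧` (`T₁ = PowerSeries.X` the OUTER variable) is the polynomial `f` with coefficients pushed into
`𝒪⟦T₂⟧`. [folklore] -/
theorem aeval_X_eq_map_coe (f : 𝒪[X]) :
    Polynomial.aeval (PowerSeries.X : PowerSeries (PowerSeries 𝒪)) f =
      PowerSeries.map (algebraMap 𝒪 (PowerSeries 𝒪)) (f : PowerSeries 𝒪) := by
  have h : (Polynomial.aeval (PowerSeries.X : PowerSeries (PowerSeries 𝒪)) : 𝒪[X] →ₐ[𝒪] PowerSeries (PowerSeries 𝒪)) =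
      Polynomial.coeToPowerSeries.algHom (PowerSeries 𝒪) := by
    refine Polynomial.algHom_ext ?_
    rw [Polynomial.aeval_X, Polynomial.coeToPowerSeries.algHom_apply, Polynomial.coe_X, PowerSeries.map_X]
  rw [h, Polynomial.coeToPowerSeries.algHom_apply]

omit [IsDomain 𝒪] [IsPrincipalIdealRing 𝒪] in
/-- The `T₁`-coefficient of `f(T₁)` in degree `natDegree f` is `1` when `f` is monic. [folklore] -/
theorem coeff_natDegree_aeval_X_of_monic {f : 𝒪[X]} (hf : f.Monic) :
    PowerSeries.coeff f.natDegree (Polynomial.aeval (PowerSeries.X : PowerSeries (PowerSeries 𝒪)) f) = 1 := by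
  rw [aeval_X_eq_map_coe, PowerSeries.coeff_map, Polynomial.coeff_coe, Polynomial.Monic.coeff_natDegree hf, map_one]

omit [IsDomain 𝒪] [IsPrincipalIdealRing 𝒪] in
/-- `f(T₂) ∈ 𝒪⟦T₂⟧⟦T₁⟧` (`T₂ = C X` the INNER variable) is the constant series on the polynomial `f ∈ 𝒪⟦T₂⟧`. [folklore] -/
theorem aeval_C_X_eq_C_coe (f : 𝒪[X]) :
    Polynomial.aeval (PowerSeries.C (PowerSeries.X : PowerSeries 𝒪) : PowerSeries (PowerSeries 𝒪)) f =
      PowerSeries.C (f : PowerSeries 𝒪) := by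
  have hφ : algebraMap 𝒪 (PowerSeries (PowerSeries 𝒪)) = (PowerSeries.C).comp PowerSeries.C := by
    ext r
    rw [PowerSeries.algebraMap_apply, PowerSeries.algebraMap_eq, RingHom.comp_apply]
  rw [Polynomial.aeval_def, hφ, ← Polynomial.hom_eval₂, Polynomial.eval₂_C_X_eq_coe]

/-- **An `𝒪⟦T₂⟧⟦T₁⟧`-module finitely generated over `𝒪` is pseudo-null, pointwise form** (`𝒪` a principal ideal domain, e.g.
`ℤ_p`): at every prime `𝔭` of height `≤ 1` every element is killed by some `r ∉ 𝔭`. (Johnson-Leung–Kings §5.1: "`Λ/𝒥_Λ`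
… isomorphic to `ℤ_p` and … hence pseudo-null"; Lemma 5.8's local terms `⊕_{v∣p} ℤ_p⟦G/D_v⟧` with `D_v` open.)
[cite: JohnsonLeungKings2011, §5.1 (arXiv p0014:L43–48) and Lemma 5.8] -/
theorem forall_exists_smul_eq_zero_of_moduleFinite [Module 𝒪 M] [IsScalarTower 𝒪 (PowerSeries (PowerSeries 𝒪)) M]
    [Module.Finite 𝒪 M] :
    ∀ 𝔭 : PrimeSpectrum (PowerSeries (PowerSeries 𝒪)), 𝔭.asIdeal.height ≤ 1 → ∀ m : M, ∃ r ∉ 𝔭.asIdeal, r • m = 0 := by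
  obtain ⟨f₁, hf₁, h₁⟩ := exists_monic_aeval_smul_eq_zero (M := M) (PowerSeries.X : PowerSeries (PowerSeries 𝒪))
  obtain ⟨f₂, hf₂, h₂⟩ := exists_monic_aeval_smul_eq_zero (M := M)
    (PowerSeries.C (PowerSeries.X : PowerSeries 𝒪) : PowerSeries (PowerSeries 𝒪))
  have hb : IsUnit (PowerSeries.coeff f₁.natDegree
      (Polynomial.aeval (PowerSeries.X : PowerSeries (PowerSeries 𝒪)) f₁)) := by
    rw [coeff_natDegree_aeval_X_of_monic hf₁]
    exact isUnit_one
  have ha : ((f₂ : 𝒪[X]) : PowerSeries 𝒪) ≠ 0 := by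
    rw [Ne, Polynomial.coe_eq_zero_iff]
    exact hf₂.ne_zero
  refine forall_exists_smul_eq_zero_of_smul_eq_zero₂ ha (fun m ↦ ?_) hb h₁
  rw [← aeval_C_X_eq_C_coe]
  exact h₂ m

/-- **An `𝒪⟦T₂⟧⟦T₁⟧`-module finitely generated over `𝒪` is pseudo-null** (`Module.IsPseudoNull`; `𝒪` a principal ideal
domain). [cite: JohnsonLeungKings2011, §5.1 (arXiv p0014:L43–48) and Lemma 5.8] -/
theorem isPseudoNull_of_moduleFinite [Module 𝒪 M] [IsScalarTower 𝒪 (PowerSeries (PowerSeries 𝒪)) M]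
    [Module.Finite 𝒪 M] : Module.IsPseudoNull (PowerSeries (PowerSeries 𝒪)) M := by
  intro 𝔭 h𝔭
  rw [LocalizedModule.subsingleton_iff]
  intro m
  obtain ⟨r, hr, hrm⟩ := forall_exists_smul_eq_zero_of_moduleFinite (M := M) 𝔭 h𝔭 m
  exact ⟨r, hr, hrm⟩

/-- **Instance-free form**: if every element of the `𝒪⟦T₂⟧⟦T₁⟧`-module `M` is a `C (C c)`-linear combination
(`c ∈ 𝒪`) of a fixed finite set, then `M` is pseudo-null, pointwise. (For carriers that come without an `𝒪`-module
instance, e.g. the tree's `…Data₂.X` duals.) [cite: JohnsonLeungKings2011, §5.1 (arXiv p0014:L43–48) and Lemma 5.8] -/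
theorem forall_exists_smul_eq_zero_of_exists_finset
    (hfg : ∃ s : Finset M, ∀ m : M, ∃ c : M → 𝒪, m = ∑ x ∈ s, (PowerSeries.C (PowerSeries.C (c x))) • x) :
    ∀ 𝔭 : PrimeSpectrum (PowerSeries (PowerSeries 𝒪)), 𝔭.asIdeal.height ≤ 1 → ∀ m : M, ∃ r ∉ 𝔭.asIdeal, r • m = 0 := by
  letI : Module 𝒪 M := Module.compHom M (algebraMap 𝒪 (PowerSeries (PowerSeries 𝒪)))
  haveI : IsScalarTower 𝒪 (PowerSeries (PowerSeries 𝒪)) M := IsScalarTower.mk fun c r m ↦ by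
    change (c • r) • m = (algebraMap 𝒪 (PowerSeries (PowerSeries 𝒪)) c) • (r • m)
    rw [Algebra.smul_def, mul_smul]
  haveI : Module.Finite 𝒪 M := by
    obtain ⟨s, hs⟩ := hfg
    refine ⟨s, ?_⟩
    rw [eq_top_iff]
    rintro m -
    obtain ⟨c, rfl⟩ := hs m
    refine Submodule.sum_mem _ fun x hx ↦ ?_
    have hC : (PowerSeries.C (PowerSeries.C (c x)) : PowerSeries (PowerSeries 𝒪)) = algebraMap 𝒪 _ (c x) := by
      rw [PowerSeries.algebraMap_apply, PowerSeries.algebraMap_eq]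
    rw [hC]
    change (c x) • x ∈ _
    exact Submodule.smul_mem _ _ (Submodule.subset_span (Finset.mem_coe.mpr hx))
  exact forall_exists_smul_eq_zero_of_moduleFinite

end CoefficientFinite

/-! ## §3b. The `Λ₂ = IwasawaAlgebra₂ p` spellings (by-name sockets for the descent files) -/

section IwasawaTwo

variable {p : ℕ} [Fact p.Prime] {M : Type u₁} [AddCommGroup M] [Module (IwasawaAlgebra₂ p) M]

/-- **A `Λ₂`-module finitely generated over `ℤ_p` is pseudo-null, pointwise form** (`Λ₂ = IwasawaAlgebra₂ p = ℤ_p⟦T₂⟧⟦T₁⟧`).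
The local defect terms of the (α3) descent are of this kind: JLK Lemma 5.8's `⊕_{v∣p} ℤ_p⟦G/D_v⟧`-modules with `D_v` open,
`p`-units modulo units, `Λ/𝒥_Λ ≅ ℤ_p`. [cite: JohnsonLeungKings2011, §5.1 (arXiv p0014:L43–48) and Lemma 5.8] -/
theorem forall_exists_smul_eq_zero_of_moduleFinite_iwasawaAlgebra₂ [Module ℤ_[p] M]
    [IsScalarTower ℤ_[p] (IwasawaAlgebra₂ p) M] [Module.Finite ℤ_[p] M] :
    ∀ 𝔭 : PrimeSpectrum (IwasawaAlgebra₂ p), 𝔭.asIdeal.height ≤ 1 → ∀ m : M, ∃ r ∉ 𝔭.asIdeal, r • m = 0 :=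
  forall_exists_smul_eq_zero_of_moduleFinite (𝒪 := ℤ_[p]) (M := M)

/-- **A `Λ₂`-module finitely generated over `ℤ_p` is pseudo-null.**
[cite: JohnsonLeungKings2011, §5.1 (arXiv p0014:L43–48) and Lemma 5.8] -/
theorem isPseudoNull_of_moduleFinite_iwasawaAlgebra₂ [Module ℤ_[p] M] [IsScalarTower ℤ_[p] (IwasawaAlgebra₂ p) M]
    [Module.Finite ℤ_[p] M] : Module.IsPseudoNull (IwasawaAlgebra₂ p) M :=
  isPseudoNull_of_moduleFinite (𝒪 := ℤ_[p]) (M := M)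

/-- **Instance-free `Λ₂` form**: every element a `C (C c)`-combination (`c ∈ ℤ_p`) of a fixed finite set ⟹ pointwise
pseudo-null. [cite: JohnsonLeungKings2011, §5.1 (arXiv p0014:L43–48) and Lemma 5.8] -/
theorem forall_exists_smul_eq_zero_of_exists_finset_iwasawaAlgebra₂
    (hfg : ∃ s : Finset M, ∀ m : M, ∃ c : M → ℤ_[p], m = ∑ x ∈ s, (PowerSeries.C (PowerSeries.C (c x))) • x) :
    ∀ 𝔭 : PrimeSpectrum (IwasawaAlgebra₂ p), 𝔭.asIdeal.height ≤ 1 → ∀ m : M, ∃ r ∉ 𝔭.asIdeal, r • m = 0 :=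
  forall_exists_smul_eq_zero_of_exists_finset (𝒪 := ℤ_[p]) (M := M) hfg

/-- **Away-from-`ϖ` reading** (the hypothesis shape of the tree's `FourTerm` producers, which quantify only over the primes
`𝔭 ∌ ϖ`): pseudo-null pointwise ⟹ away-null pointwise, any `ϖ`. [folklore] -/
theorem forall_away_of_forall {R : Type*} [CommRing R] {N : Type u₂} [AddCommGroup N] [Module R N] (ϖ : R)
    (h : ∀ 𝔭 : PrimeSpectrum R, 𝔭.asIdeal.height ≤ 1 → ∀ m : N, ∃ r ∉ 𝔭.asIdeal, r • m = 0) :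
    ∀ 𝔭 : PrimeSpectrum R, 𝔭.asIdeal.height ≤ 1 → ϖ ∉ 𝔭.asIdeal → ∀ m : N, ∃ r ∉ 𝔭.asIdeal, r • m = 0 :=
  fun 𝔭 h𝔭 _ ↦ h 𝔭 h𝔭

end IwasawaTwo

/-! ## §4. Pointwise nullity at a prime is closed under extensions, submodules, quotients, images -/

section Closure

variable {R : Type*} [CommRing R] {N : Type u₁} [AddCommGroup N] [Module R N]
  {M : Type u₂} [AddCommGroup M] [Module R M] {Q : Type u₃} [AddCommGroup Q] [Module R Q]

/-- **Extensions**: if `N → M → Q` is exact at `M` (`Function.Exact f g`) and both `N` and `Q` are pointwise-null at the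
prime `𝔭` (every element killed by some `r ∉ 𝔭`), so is `M`. Hence «pseudo-null-by-`p`-primary» and
«`p`-primary-by-pseudo-null» defects are away-null alike. [cite: NeukirchSchmidtWingberg2008, Ch. V §1, (5.1.4) Remark 1] -/
theorem forall_exists_smul_eq_zero_of_exact (𝔭 : Ideal R) [h𝔭 : 𝔭.IsPrime] (f : N →ₗ[R] M) (g : M →ₗ[R] Q)
    (hfg : Function.Exact f g) (hN : ∀ n : N, ∃ r ∉ 𝔭, r • n = 0) (hQ : ∀ q : Q, ∃ r ∉ 𝔭, r • q = 0) :
    ∀ m : M, ∃ r ∉ 𝔭, r • m = 0 := by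
  intro m
  obtain ⟨r₁, hr₁, h₁⟩ := hQ (g m)
  obtain ⟨n, hn⟩ := (hfg (r₁ • m)).mp (by rw [map_smul, h₁])
  obtain ⟨r₂, hr₂, h₂⟩ := hN n
  refine ⟨r₂ * r₁, fun hmem ↦ (h𝔭.mem_or_mem hmem).elim hr₂ hr₁, ?_⟩
  rw [mul_smul, ← hn, ← map_smul, h₂, map_zero]

/-- **Submodules** (injective maps): pointwise nullity at `𝔭` passes to the source of an injective map. [folklore] -/
theorem forall_exists_smul_eq_zero_of_injective (𝔭 : Ideal R) (f : N →ₗ[R] M) (hf : Function.Injective f)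
    (hM : ∀ m : M, ∃ r ∉ 𝔭, r • m = 0) : ∀ n : N, ∃ r ∉ 𝔭, r • n = 0 := by
  intro n
  obtain ⟨r, hr, h⟩ := hM (f n)
  exact ⟨r, hr, hf (by rw [map_smul, h, map_zero])⟩

/-- **Quotients / images** (surjective maps): pointwise nullity at `𝔭` passes to the target of a surjective map. [folklore] -/
theorem forall_exists_smul_eq_zero_of_surjective (𝔭 : Ideal R) (g : M →ₗ[R] Q) (hg : Function.Surjective g)
    (hM : ∀ m : M, ∃ r ∉ 𝔭, r • m = 0) : ∀ q : Q, ∃ r ∉ 𝔭, r • q = 0 := by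
  intro q
  obtain ⟨m, rfl⟩ := hg q
  obtain ⟨r, hr, h⟩ := hM m
  exact ⟨r, hr, by rw [← map_smul, h, map_zero]⟩

/-- **Ranges**: the range of a map out of a pointwise-null module is pointwise-null. [folklore] -/
theorem forall_exists_smul_eq_zero_range (𝔭 : Ideal R) (f : N →ₗ[R] M) (hN : ∀ n : N, ∃ r ∉ 𝔭, r • n = 0) :
    ∀ y : LinearMap.range f, ∃ r ∉ 𝔭, r • y = 0 :=
  forall_exists_smul_eq_zero_of_surjective 𝔭 f.rangeRestrict (LinearMap.surjective_rangeRestrict f) hN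

/-- **Submodule + quotient**: if a submodule `N' ≤ M` and the quotient `M ⧸ N'` are pointwise-null at `𝔭`, so is `M`.
[cite: NeukirchSchmidtWingberg2008, Ch. V §1, (5.1.4) Remark 1] -/
theorem forall_exists_smul_eq_zero_of_submodule_quotient (𝔭 : Ideal R) [𝔭.IsPrime] (N' : Submodule R M)
    (hN : ∀ n : N', ∃ r ∉ 𝔭, r • n = 0) (hQ : ∀ q : M ⧸ N', ∃ r ∉ 𝔭, r • q = 0) :
    ∀ m : M, ∃ r ∉ 𝔭, r • m = 0 :=
  forall_exists_smul_eq_zero_of_exact 𝔭 N'.subtype N'.mkQ (LinearMap.exact_subtype_mkQ N') hN hQ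

/-- **A fixed annihilator outside `𝔭`**: if every element of `M` is killed by one `c ∉ 𝔭`, `M` is pointwise-null at `𝔭`.
[folklore] -/
theorem forall_exists_smul_eq_zero_of_smul_eq_zero (𝔭 : Ideal R) {c : R} (hc : c ∉ 𝔭) (h : ∀ m : M, c • m = 0) :
    ∀ m : M, ∃ r ∉ 𝔭, r • m = 0 :=
  fun m ↦ ⟨c, hc, h m⟩

end Closure

end Summit.BirchSwinnertonDyer.BirchSwinnertonDyer.Theorems.PrintCf2.JLKDescent

end
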